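import Literature.AlgebraicGeometry.Motives.UniversalHypersurfaceRegularLocusChartCoeff
import Literature.AlgebraicGeometry.HodgeTheory.CyclicCoverFormNonsingular
import Literature.AlgebraicGeometry.HodgeTheory.UniversalHypersurfaceDiscriminant
import HarnessLib

/-!
# The solved coefficient in the chart `x₂ ≠ 0` of the cyclic-cover pencil: `b_{x₂^p} = −(y₃^p − f(y₀, y₁, 1)) − coeff_{x₂^p} f`

Family `hodge`, layer `Literature/AlgebraicGeometry/HodgeTheory`; sequel of `Motives/UniversalHypersurfaceRegularLocusChartCoeff`. For the surface
`x₃^p = f(x₀, x₁, x₂)` (`cyclicCoverForm p f = x₃^p − f`, Carlson–Toledo 1999 §2) with coefficient vector `b₀ = coeffsOf (cyclicCoverForm p f)`,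
the coefficient solved for by the chart `regChartFun 2 p 2` of the regular locus — that of `x₂^p`, the coefficient that MOVES in the pencil
`x₃^p = f + c·x₂^p` — is, as a function of the affine coordinates `y = (x₀, x₁, x₃)/x₂` at fixed remaining coefficients `b'₀`,
`−(y₂^p − f(y₀, y₁, 1)) − coeff_{x₂^p}(f)`; for the one-nodal form `f₁ = x₂^{p−2}x₀x₁ + x₀^p + x₁^p` this is `−φ(y)`,
`φ(y) = y₂^p − (y₀y₁ + y₀^p + y₁^p)` — the pencil function of `Geometry/ComplexAnalytic/CyclicNodePencilMorseChart`. With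
`Motives/UniversalHypersurfaceRegularLocusChartPartial` / `…ChartSubmersion` and `Geometry/ComplexAnalytic/CyclicNodePencilShellSubmersion`
this is the last identity needed for the joint-submersion hypothesis of the tangent-lift lemma on the Morse shells (programme discharging
`HodgeTheory/CyclicCoverNodalMeridianLocalMonodromyBound`).

* `eval_insertNth_cyclicCoverForm` — `F_{b₀}(y₀, y₁, 1, y₂) = y₂^p − f(y₀, y₁, 1)`;
* `coeffsOf_cyclicCoverForm_regPowIndex` — `(b₀)_{x₂^p} = −coeff_{x₂^p} f`;
* `regChartCoeffVec_pencil_regPowIndex` — **the solved coefficient at `(b'₀, y)` is `−(y₂^p − f(y₀,y₁,1)) − coeff_{x₂^p} f`**;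
* `regChartCoeffVec_nodalPencil_regPowIndex` — for `f₁ = x₂^{p−2}x₀x₁ + x₀^p + x₁^p` (`p ≥ 3`) it is `−(y₂^p − (y₀y₁ + y₀^p + y₁^p))`.

Everything is proved; no definitions, no named facts.

## References

* [CarlsonToledo1999] J. A. Carlson, D. Toledo, Discriminant complements and kernels of monodromy representations, Duke Math. J. 97 (1999),
  §2 (universalcyclic), §6 (kdoublept).
* [VoisinHodgeII2003] C. Voisin, Hodge Theory and Complex Algebraic Geometry II (2003), §2.3 (Lefschetz pencils), §6.2.1.
-/

noncomputable section

open MvPolynomial Set Function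
open Literature.AlgebraicGeometry.Motives Literature.AlgebraicGeometry.Motives.UniversalHypersurface
open Literature.AlgebraicGeometry.HodgeTheory.UniversalHypersurface

namespace Literature.AlgebraicGeometry.HodgeTheory

variable (p : ℕ)

/-- `(ins₂ 1 y) 3 = y 2` and `(ins₂ 1 y) ∘ castSucc = (y 0, y 1, 1)`: the point of `ℂ⁴` with `x₂ = 1` over the affine coordinates `y`.
[cite: CarlsonToledo1999, §2] -/
theorem insertNth_two_comp_castSucc (y : Fin 3 → ℂ) :
    ((Fin.insertNth (2 : Fin 4) (1 : ℂ) y : Fin 4 → ℂ) ∘ Fin.castSucc) = ![y 0, y 1, 1] ∧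
      (Fin.insertNth (2 : Fin 4) (1 : ℂ) y : Fin 4 → ℂ) (Fin.last 3) = y 2 := by
  have e0 : (2 : Fin 4).succAbove (0 : Fin 3) = 0 := by decide
  have e1 : (2 : Fin 4).succAbove (1 : Fin 3) = 1 := by decide
  have e3 : (2 : Fin 4).succAbove (2 : Fin 3) = 3 := by decide
  have h0 : (Fin.insertNth (2 : Fin 4) (1 : ℂ) y : Fin 4 → ℂ) 0 = y 0 := by
    have h := Fin.insertNth_apply_succAbove (α := fun _ : Fin 4 => ℂ) (2 : Fin 4) (1 : ℂ) y 0
    rwa [e0] at h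
  have h1 : (Fin.insertNth (2 : Fin 4) (1 : ℂ) y : Fin 4 → ℂ) 1 = y 1 := by
    have h := Fin.insertNth_apply_succAbove (α := fun _ : Fin 4 => ℂ) (2 : Fin 4) (1 : ℂ) y 1
    rwa [e1] at h
  have h2 : (Fin.insertNth (2 : Fin 4) (1 : ℂ) y : Fin 4 → ℂ) 2 = 1 := Fin.insertNth_apply_same (α := fun _ : Fin 4 => ℂ) (2 : Fin 4) (1 : ℂ) y
  have h3 : (Fin.insertNth (2 : Fin 4) (1 : ℂ) y : Fin 4 → ℂ) 3 = y 2 := by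
    have h := Fin.insertNth_apply_succAbove (α := fun _ : Fin 4 => ℂ) (2 : Fin 4) (1 : ℂ) y 2
    rwa [e3] at h
  refine ⟨?_, h3⟩
  funext k
  fin_cases k
  · exact h0
  · exact h1
  · exact h2

/-- **`F_{b₀}(y₀, y₁, 1, y₂) = y₂^p − f(y₀, y₁, 1)`** for `F = x₃^p − f(x₀, x₁, x₂)`. [cite: CarlsonToledo1999, §2 (universalcyclic)] -/
theorem eval_insertNth_cyclicCoverForm (f : MvPolynomial (Fin 3) ℂ) (y : Fin 3 → ℂ) :
    MvPolynomial.eval (Fin.insertNth (2 : Fin 4) (1 : ℂ) y : Fin 4 → ℂ) (cyclicCoverForm p f) =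
      y 2 ^ p - MvPolynomial.eval ![y 0, y 1, 1] f := by
  obtain ⟨hc, h3⟩ := insertNth_two_comp_castSucc y
  rw [cyclicCoverForm_def, map_sub, map_pow, MvPolynomial.eval_X, h3, MvPolynomial.eval_rename, hc]

/-- The coefficient of `x₂^p` in `x₃^p − f` is `−coeff_{x₂^p} f` (`p ≥ 1`). [cite: CarlsonToledo1999, §2] -/
theorem coeff_cyclicCoverForm_single_two (hp : 0 < p) (f : MvPolynomial (Fin 3) ℂ) :
    MvPolynomial.coeff (Finsupp.single (2 : Fin 4) p) (cyclicCoverForm p f) =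
      -MvPolynomial.coeff (Finsupp.single (2 : Fin 3) p) f := by
  rw [cyclicCoverForm_def, MvPolynomial.coeff_sub, MvPolynomial.coeff_X_pow]
  have hne : Finsupp.single (Fin.last 3) p ≠ Finsupp.single (2 : Fin 4) p := by
    intro h
    have := Finsupp.single_left_injective hp.ne' |>.eq_iff.mp h
    exact absurd this (by decide)
  rw [if_neg hne, zero_sub, neg_inj]
  have hmap : Finsupp.single (2 : Fin 4) p = Finsupp.mapDomain Fin.castSucc (Finsupp.single (2 : Fin 3) p) := by
    rw [Finsupp.mapDomain_single]; rfl
  rw [hmap, MvPolynomial.coeff_rename_mapDomain _ (Fin.castSucc_injective 3)]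

/-- **The solved coefficient of the chart `x₂ ≠ 0` along the cyclic-cover pencil**: with `b₀ = coeffsOf (x₃^p − f)` (`f` homogeneous of degree
`p ≥ 1`) and `b'₀` its restriction off `x₂^p`, for every `y`:
`regChartCoeffVec 2 p 2 (b'₀, y) (x₂^p) = −(y₂^p − f(y₀, y₁, 1)) − coeff_{x₂^p} f`. [cite: CarlsonToledo1999, §2] [cite: VoisinHodgeII2003, §2.3] -/
theorem regChartCoeffVec_pencil_regPowIndex (hp : 0 < p) {f : MvPolynomial (Fin 3) ℂ} (hf : f.IsHomogeneous p) (y : Fin 3 → ℂ) :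
    regChartCoeffVec 2 p 2
        (Sum.elim (fun m : {m : DegIndex 2 p // m ≠ regPowIndex 2 p 2} => coeffsOf 2 p (cyclicCoverForm p f) m.1) y)
        (regPowIndex 2 p 2) =
      -(y 2 ^ p - MvPolynomial.eval ![y 0, y 1, 1] f) - MvPolynomial.coeff (Finsupp.single (2 : Fin 3) p) f := by
  classical
  set b₀ : DegIndex 2 p → ℂ := coeffsOf 2 p (cyclicCoverForm p f) with hb₀
  set w : Fin 4 → ℂ := Fin.insertNth (2 : Fin 4) (1 : ℂ) y with hw
  rw [regChartCoeffVec_regPowIndex]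
  -- the full sum is the evaluation of `F = formOfCoeffs b₀` at `w`
  have hform : formOfCoeffs b₀ = cyclicCoverForm p f := by
    rw [hb₀]
    exact formOfCoeffs_coeff (cyclicCoverForm p f) (CyclicCoverFormNonsingular.isHomogeneous_cyclicCoverForm_of_isHomogeneous hf)
  have hsum := eval_formOfCoeffs 2 p b₀ w
  rw [hform, eval_insertNth_cyclicCoverForm, Fintype.sum_eq_add_sum_subtype_ne _ (regPowIndex 2 p 2), prod_regPowIndex] at hsum
  have hw2 : w 2 = 1 := by rw [hw]; exact Fin.insertNth_apply_same (α := fun _ : Fin 4 => ℂ) (2 : Fin 4) (1 : ℂ) y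
  rw [hw2, one_pow, mul_one] at hsum
  have hb₀m : b₀ (regPowIndex 2 p 2) = -MvPolynomial.coeff (Finsupp.single (2 : Fin 3) p) f := by
    rw [hb₀, coeffsOf_apply]
    exact coeff_cyclicCoverForm_single_two p hp f
  -- identify the two sums over `{m ≠ x₂^p}`
  have hterms : (∑ m' : {m : DegIndex 2 p // m ≠ regPowIndex 2 p 2},
      Sum.elim (fun m : {m : DegIndex 2 p // m ≠ regPowIndex 2 p 2} => b₀ m.1) y (Sum.inl m') *
        (m'.1.1.prod fun k e =>
          (Fin.insertNth (2 : Fin 4) (1 : ℂ) (fun j => Sum.elim (fun m : {m : DegIndex 2 p // m ≠ regPowIndex 2 p 2} => b₀ m.1) y (Sum.inr j)) :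
            Fin 4 → ℂ) k ^ e)) =
      ∑ m' : {m : DegIndex 2 p // m ≠ regPowIndex 2 p 2}, b₀ m'.1 * m'.1.1.prod fun k e => w k ^ e := by
    refine Finset.sum_congr rfl fun m' _ => ?_
    rfl
  rw [hterms]
  linear_combination hsum + hb₀m

/-- **For the one-nodal form `f₁ = x₂^{p−2}x₀x₁ + x₀^p + x₁^p`** (`p ≥ 3`) the solved coefficient is `−φ(y)`,
`φ(y) = y₂^p − (y₀y₁ + y₀^p + y₁^p)` (the pencil function of `CyclicNodePencilMorseChart`). [cite: CarlsonToledo1999, §6 (kdoublept)] -/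
theorem regChartCoeffVec_nodalPencil_regPowIndex (hp : 3 ≤ p) (y : Fin 3 → ℂ) :
    regChartCoeffVec 2 p 2
        (Sum.elim (fun m : {m : DegIndex 2 p // m ≠ regPowIndex 2 p 2} =>
          coeffsOf 2 p (cyclicCoverForm p (X 2 ^ (p - 2) * (X 0 * X 1) + X 0 ^ p + X 1 ^ p)) m.1) y)
        (regPowIndex 2 p 2) =
      -(y 2 ^ p - (y 0 * y 1 + y 0 ^ p + y 1 ^ p)) := by
  obtain ⟨m, rfl⟩ : ∃ m, p = m + 3 := ⟨p - 3, by omega⟩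
  have hf : (X 2 ^ (m + 3 - 2) * (X 0 * X 1) + X 0 ^ (m + 3) + X 1 ^ (m + 3) : MvPolynomial (Fin 3) ℂ).IsHomogeneous (m + 3) := by
    have h1 : (X 2 ^ (m + 3 - 2) * (X 0 * X 1) : MvPolynomial (Fin 3) ℂ).IsHomogeneous (m + 3) := by
      have := (isHomogeneous_X_pow (R := ℂ) (2 : Fin 3) (m + 3 - 2)).mul
        ((isHomogeneous_X ℂ (0 : Fin 3)).mul (isHomogeneous_X ℂ (1 : Fin 3)))
      convert this using 1
      omega
    exact (h1.add (isHomogeneous_X_pow (0 : Fin 3) (m + 3))).add (isHomogeneous_X_pow (1 : Fin 3) (m + 3))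
  rw [regChartCoeffVec_pencil_regPowIndex (m + 3) (by omega) hf y]
  have hcoeff : MvPolynomial.coeff (Finsupp.single (2 : Fin 3) (m + 3))
      (X 2 ^ (m + 3 - 2) * (X 0 * X 1) + X 0 ^ (m + 3) + X 1 ^ (m + 3) : MvPolynomial (Fin 3) ℂ) = 0 := by
    rw [MvPolynomial.coeff_add, MvPolynomial.coeff_add, MvPolynomial.coeff_X_pow, MvPolynomial.coeff_X_pow]
    have h0 : Finsupp.single (0 : Fin 3) (m + 3) ≠ Finsupp.single (2 : Fin 3) (m + 3) := by
      intro h; have := (Finsupp.single_left_injective (by omega : m + 3 ≠ 0)).eq_iff.mp h; exact absurd this (by decide)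
    have h1 : Finsupp.single (1 : Fin 3) (m + 3) ≠ Finsupp.single (2 : Fin 3) (m + 3) := by
      intro h; have := (Finsupp.single_left_injective (by omega : m + 3 ≠ 0)).eq_iff.mp h; exact absurd this (by decide)
    rw [if_neg h0, if_neg h1, add_zero, add_zero]
    rw [show (X 2 ^ (m + 3 - 2) * (X 0 * X 1) : MvPolynomial (Fin 3) ℂ) = X 0 * (X 1 * X 2 ^ (m + 3 - 2)) by ring,
      MvPolynomial.coeff_X_mul', if_neg]
    rw [Finsupp.mem_support_iff, Finsupp.single_apply, if_neg (by decide)]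
    exact fun h => h rfl
  rw [hcoeff, sub_zero]
  have hev : MvPolynomial.eval ![y 0, y 1, 1]
      (X 2 ^ (m + 3 - 2) * (X 0 * X 1) + X 0 ^ (m + 3) + X 1 ^ (m + 3) : MvPolynomial (Fin 3) ℂ) =
      y 0 * y 1 + y 0 ^ (m + 3) + y 1 ^ (m + 3) := by
    simp [MvPolynomial.eval_X]
  rw [hev]

end Literature.AlgebraicGeometry.HodgeTheory

end
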